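import Mathlib
import Summits.AtomisticToContinuum.FouriersLaw.Theorems.EmbeddedDrudeMourreMourreDissolutionFibreTwoZeroFloorZeros
import HarnessLib

/-!
# `MourreDissolution`, line `swap-odd-threshold-rigidity`, stub TZ `stub_fibreTwoZeroFloor` — part C (assembly)

Helper file (supports crux item `stmt-AtomisticToContinuum-12594`, route `EmbeddedDrudeMourre`,
sub-problem `FouriersLaw`; lead c8). THE UNIFORM TWO-ZERO FLOOR of the resonance function `Ω(k₁,k₂,k₃)`
of the pinned phonon band along its `k₂`-fibres: for `ω₂ > 0` there is `m > 0` such that on every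
non-degenerate fibre (`sin((k₃−k₁)/2) ≠ 0`, `ω′(k₃) ≠ ω′(k₁)`) some point `kt` satisfies
`|Ω(k₁,k₂,k₃)| ≥ m |sin((k₃−k₁)/2) sin((k₂−k₃)/2) sin((k₂−kt)/2)|` for all real `k₂`.

Proof: by the global factorisation `Ω·D = 8 sin((k₃−k₁)/2) sin((k₂−k₃)/2)·H` (I1) it suffices to bound
`|H|` below by `η|sin((k₂−kt)/2)|` with `kt` a zero of `H(k₁,·,k₃)`; a zero exists (`H` is
`2π`-antiperiodic in `k₂`), all zeros of `H` on a non-degenerate fibre are congruent mod `2π` (they are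
zeros of `Ω`; a zero at `k₃` is excluded by the velocity identity of TA; then
`FGRGap…Branch.two_classes`), and the compactness floor `|H| < η ⇒ |G| ≥ η` (part A, from TA ∧ TB)
together with the near-zero lemma of part A puts every point with `|H| < η` within `|H|/η` of a zero.
Periodicity reduces general momenta to the box `[−π,π]³`.

References: Aoki–Lukkarinen–Spohn 2006 §4; Lukkarinen 2016 §2.2.4 (the branch `h`); folklore.
-/

noncomputable section

open Set Real

namespace Summit.AtomisticToContinuum.FouriersLaw.Theorems.MourreDissolution

open Literature.MathematicalPhysics.KineticTheory.PhononBoltzmann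

/-! ## 4. The floor of `|H|` on a non-degenerate fibre of the box -/

/-- On a non-degenerate fibre with `k₁, k₃ ∈ [−π, π]`, given the compactness floor `η` of part A, some
zero `kt` of `H(k₁,·,k₃)` satisfies `η|sin((k₂−kt)/2)| ≤ |H(k₁,k₂,k₃)|` for every `k₂ ∈ [−π, π]`
(near-zero lemma: a point with `|H| < η` is within `|H|/η < 1` of a zero, which is congruent to `kt`;
`|sin(x/2)| ≤ |x|/2`). [folklore] -/
theorem fibreTwoZeroFloor_sheet_floor_box {ω₂ η : ℝ} (hω : 0 < ω₂) (hη : 0 < η)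
    (hfloor : ∀ k₁ k₂ k₃ : ℝ, k₁ ∈ Icc (-π) π → k₂ ∈ Icc (-(3 * π)) (3 * π) → k₃ ∈ Icc (-π) π →
      |((dispersion ω₂ k₁ * dispersion ω₂ k₂ + dispersion ω₂ k₃ * dispersion ω₂ (k₁ + k₂ - k₃) +
              2 * (ω₂ + 2)) * Real.cos ((k₁ + k₂) / 2) -
          4 * Real.cos ((k₃ - k₁) / 2) * Real.cos ((k₂ - k₃) / 2))| < η →
      η ≤ |((dispersion ω₂ k₁ * groupVelocity ω₂ k₂ + dispersion ω₂ k₃ * groupVelocity ω₂ (k₁ + k₂ - k₃)) *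
              Real.cos ((k₁ + k₂) / 2) -
            1 / 2 * (dispersion ω₂ k₁ * dispersion ω₂ k₂ + dispersion ω₂ k₃ * dispersion ω₂ (k₁ + k₂ - k₃) +
              2 * (ω₂ + 2)) * Real.sin ((k₁ + k₂) / 2) +
          2 * Real.cos ((k₃ - k₁) / 2) * Real.sin ((k₂ - k₃) / 2))|)
    {k₁ k₃ : ℝ} (hk₁ : k₁ ∈ Icc (-π) π) (hk₃ : k₃ ∈ Icc (-π) π)
    (hsp : Real.sin ((k₃ - k₁) / 2) ≠ 0) (hv : groupVelocity ω₂ k₃ ≠ groupVelocity ω₂ k₁) :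
    ∃ kt : ℝ, ∀ k₂ : ℝ, k₂ ∈ Icc (-π) π →
      η * |Real.sin ((k₂ - kt) / 2)| ≤
        |((dispersion ω₂ k₁ * dispersion ω₂ k₂ + dispersion ω₂ k₃ * dispersion ω₂ (k₁ + k₂ - k₃) +
              2 * (ω₂ + 2)) * Real.cos ((k₁ + k₂) / 2) -
          4 * Real.cos ((k₃ - k₁) / 2) * Real.cos ((k₂ - k₃) / 2))| := by
  obtain ⟨kt, hkt⟩ := fibreTwoZeroFloor_exists_zero ω₂ k₁ k₃
  refine ⟨kt, fun k₂ hk₂ => ?_⟩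
  set h : ℝ → ℝ := fun q =>
      ((dispersion ω₂ k₁ * dispersion ω₂ q + dispersion ω₂ k₃ * dispersion ω₂ (k₁ + q - k₃) +
              2 * (ω₂ + 2)) * Real.cos ((k₁ + q) / 2) -
          4 * Real.cos ((k₃ - k₁) / 2) * Real.cos ((q - k₃) / 2)) with hh
  set g : ℝ → ℝ := fun q =>
      ((dispersion ω₂ k₁ * groupVelocity ω₂ q + dispersion ω₂ k₃ * groupVelocity ω₂ (k₁ + q - k₃)) *
              Real.cos ((k₁ + q) / 2) -
            1 / 2 * (dispersion ω₂ k₁ * dispersion ω₂ q + dispersion ω₂ k₃ * dispersion ω₂ (k₁ + q - k₃) +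
              2 * (ω₂ + 2)) * Real.sin ((k₁ + q) / 2) +
          2 * Real.cos ((k₃ - k₁) / 2) * Real.sin ((q - k₃) / 2)) with hg
  have hsin1 : |Real.sin ((k₂ - kt) / 2)| ≤ 1 := Real.abs_sin_le_one _
  by_cases hbig : η ≤ |h k₂|
  · calc η * |Real.sin ((k₂ - kt) / 2)| ≤ η * 1 := by gcongr
      _ = η := mul_one η
      _ ≤ |h k₂| := hbig
  · push Not at hbig
    have hderiv : ∀ x, HasDerivAt h (g x) x := fun x => by
      simp only [hh, hg]; exact sheetTransversal_hasDerivAt_sheetFn hω k₁ x k₃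
    have hgc : Continuous g := by
      have hd := levelShift_continuous_dispersion ω₂
      have hvc := FGRGap.FoldJetRigidity.Branch.continuous_groupVelocity hω
      simp only [hg]; fun_prop
    have hlt1 : |h k₂| / η < 1 := (div_lt_one hη).2 hbig
    have hsmall : ∀ x ∈ Icc (k₂ - |h k₂| / η) (k₂ + |h k₂| / η), |h x| < η → η ≤ |g x| := by
      intro x hx hxη
      have hxbox : x ∈ Icc (-(3 * π)) (3 * π) := by
        have hnn : 0 ≤ |h k₂| / η := div_nonneg (abs_nonneg (h k₂)) hη.le
        constructor <;> linarith [hx.1, hx.2, hk₂.1, hk₂.2, hlt1, Real.pi_gt_three]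
      exact hfloor k₁ x k₃ hk₁ hxbox hk₃ (by simpa [hh] using hxη)
    obtain ⟨z, hz0, hzd⟩ := nearZero hη hderiv hgc hbig hsmall
    obtain ⟨n, hn⟩ := fibreTwoZeroFloor_one_class ω₂ hω k₁ k₃ kt z hsp hv hkt (by simpa [hh] using hz0)
    -- `|sin((k₂ - kt)/2)| = |sin((k₂ - z)/2)| ≤ |k₂ - z|/2 ≤ |h k₂|/(2η)`
    have hs : |Real.sin ((k₂ - kt) / 2)| = |Real.sin ((k₂ - z) / 2)| := by
      rw [show k₂ - kt = (k₂ - z) + n * (2 * π) by linarith, fibreTwoZeroFloor_abs_sin_half_add_int]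
    rw [hs]
    have h1 : |Real.sin ((k₂ - z) / 2)| ≤ |(k₂ - z) / 2| := Real.abs_sin_le_abs
    rw [abs_div, abs_two] at h1
    have h2 : |k₂ - z| ≤ |h k₂| / η := hzd
    calc η * |Real.sin ((k₂ - z) / 2)| ≤ η * (|h k₂| / η / 2) := by
          gcongr; exact h1.trans (by linarith)
      _ = |h k₂| / 2 := by rw [mul_div_assoc', mul_div_cancel₀ _ hη.ne']
      _ ≤ |h k₂| := by linarith [abs_nonneg (h k₂)]

/-! ## 5. Assembly -/

/-- The core statement on the box: for `k₁, k₃ ∈ [−π,π]` non-degenerate there is `kt` with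
`m|sin((k₃−k₁)/2) sin((k₂−k₃)/2) sin((k₂−kt)/2)| ≤ |Ω|` for ALL real `k₂` (`k₂` reduced mod `2π` to the
box; `m = η (ω₂+4)^{−3/2}`). [folklore] -/
theorem fibreTwoZeroFloor_core {ω₂ η : ℝ} (hω : 0 < ω₂) (hη : 0 < η)
    (hfloor : ∀ k₁ k₂ k₃ : ℝ, k₁ ∈ Icc (-π) π → k₂ ∈ Icc (-(3 * π)) (3 * π) → k₃ ∈ Icc (-π) π →
      |((dispersion ω₂ k₁ * dispersion ω₂ k₂ + dispersion ω₂ k₃ * dispersion ω₂ (k₁ + k₂ - k₃) +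
              2 * (ω₂ + 2)) * Real.cos ((k₁ + k₂) / 2) -
          4 * Real.cos ((k₃ - k₁) / 2) * Real.cos ((k₂ - k₃) / 2))| < η →
      η ≤ |((dispersion ω₂ k₁ * groupVelocity ω₂ k₂ + dispersion ω₂ k₃ * groupVelocity ω₂ (k₁ + k₂ - k₃)) *
              Real.cos ((k₁ + k₂) / 2) -
            1 / 2 * (dispersion ω₂ k₁ * dispersion ω₂ k₂ + dispersion ω₂ k₃ * dispersion ω₂ (k₁ + k₂ - k₃) +
              2 * (ω₂ + 2)) * Real.sin ((k₁ + k₂) / 2) +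
          2 * Real.cos ((k₃ - k₁) / 2) * Real.sin ((k₂ - k₃) / 2))|)
    {k₁ k₃ : ℝ} (hk₁ : k₁ ∈ Icc (-π) π) (hk₃ : k₃ ∈ Icc (-π) π)
    (hsp : Real.sin ((k₃ - k₁) / 2) ≠ 0) (hv : groupVelocity ω₂ k₃ ≠ groupVelocity ω₂ k₁) :
    ∃ kt : ℝ, ∀ k₂ : ℝ,
      η / ((ω₂ + 4) * Real.sqrt (ω₂ + 4)) *
          |Real.sin ((k₃ - k₁) / 2) * Real.sin ((k₂ - k₃) / 2) * Real.sin ((k₂ - kt) / 2)| ≤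
        |resonanceFn ω₂ k₁ k₂ k₃| := by
  obtain ⟨kt, hkt⟩ := fibreTwoZeroFloor_sheet_floor_box hω hη hfloor hk₁ hk₃ hsp hv
  refine ⟨kt, fun k₂ => ?_⟩
  have hMpos : 0 < (ω₂ + 4) * Real.sqrt (ω₂ + 4) := by
    have : 0 < Real.sqrt (ω₂ + 4) := Real.sqrt_pos.2 (by linarith)
    positivity
  -- reduce `k₂` to the box
  obtain ⟨n, hn⟩ := bracketModulus_exists_reduce k₂
  set k₂' := k₂ - n * (2 * π) with hk₂'
  have hk₂'mem : k₂' ∈ Icc (-π) π := abs_le.1 hn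
  have hk₂eq : k₂ = k₂' + n * (2 * π) := by rw [hk₂']; ring
  have hΩ : resonanceFn ω₂ k₁ k₂ k₃ = resonanceFn ω₂ k₁ k₂' k₃ := by
    have p₂ := (fibreTwoZeroFloor_resonanceFn_periodic₂ ω₂ k₁ k₃).int_mul n k₂'
    rw [hk₂eq, p₂]
  have hs₂ : |Real.sin ((k₂ - k₃) / 2)| = |Real.sin ((k₂' - k₃) / 2)| := by
    rw [hk₂eq, show k₂' + n * (2 * π) - k₃ = (k₂' - k₃) + n * (2 * π) by ring,
      fibreTwoZeroFloor_abs_sin_half_add_int]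
  have hst : |Real.sin ((k₂ - kt) / 2)| = |Real.sin ((k₂' - kt) / 2)| := by
    rw [hk₂eq, show k₂' + n * (2 * π) - kt = (k₂' - kt) + n * (2 * π) by ring,
      fibreTwoZeroFloor_abs_sin_half_add_int]
  have hfl := hkt k₂' hk₂'mem
  have hge := fibreTwoZeroFloor_abs_resonanceFn_ge hω k₁ k₂' k₃
  rw [hΩ, abs_mul, abs_mul, hs₂, hst]
  rw [abs_mul] at hge
  have h0 : 0 ≤ |Real.sin ((k₃ - k₁) / 2)| * |Real.sin ((k₂' - k₃) / 2)| := by positivity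
  calc η / ((ω₂ + 4) * Real.sqrt (ω₂ + 4)) *
        (|Real.sin ((k₃ - k₁) / 2)| * |Real.sin ((k₂' - k₃) / 2)| * |Real.sin ((k₂' - kt) / 2)|)
      = |Real.sin ((k₃ - k₁) / 2)| * |Real.sin ((k₂' - k₃) / 2)| * (η * |Real.sin ((k₂' - kt) / 2)|) /
          ((ω₂ + 4) * Real.sqrt (ω₂ + 4)) := by ring
    _ ≤ |Real.sin ((k₃ - k₁) / 2)| * |Real.sin ((k₂' - k₃) / 2)| *
          |((dispersion ω₂ k₁ * dispersion ω₂ k₂' + dispersion ω₂ k₃ * dispersion ω₂ (k₁ + k₂' - k₃) +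
              2 * (ω₂ + 2)) * Real.cos ((k₁ + k₂') / 2) -
          4 * Real.cos ((k₃ - k₁) / 2) * Real.cos ((k₂' - k₃) / 2))| /
          ((ω₂ + 4) * Real.sqrt (ω₂ + 4)) := by gcongr
    _ ≤ |resonanceFn ω₂ k₁ k₂' k₃| := hge

/-- **STUB TZ `stub_fibreTwoZeroFloor`** (lead c8, line `swap-odd-threshold-rigidity`, crux
`MourreDissolution`): THE UNIFORM TWO-ZERO FLOOR OF THE RESONANCE FUNCTION ALONG ITS `k₂`-FIBRES,
registered as `TA → TB → TZ`. For `ω₂ > 0` there is `m > 0` such that on every non-degenerate fibre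
(`sin((k₃−k₁)/2) ≠ 0`, `ω′(k₃) ≠ ω′(k₁)`) some `kt` satisfies
`m|sin((k₃−k₁)/2) sin((k₂−k₃)/2) sin((k₂−kt)/2)| ≤ |Ω(k₁,k₂,k₃)|` for all real `k₂`. Proof: compactness
floor (part A, from TA ∧ TB) + the core on the box + reduction of `k₁, k₃` mod `2π`.
[cite: AokiLukkarinenSpohn2006, §4 eqs. (4.2)-(4.8)] -/
theorem stub_fibreTwoZeroFloor :
    (∀ ω₂ : ℝ, 0 < ω₂ → ∃ c : ℝ, 0 < c ∧ ∀ k₁ k₂ k₃ : ℝ,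
      ((dispersion ω₂ k₁ * dispersion ω₂ k₂ + dispersion ω₂ k₃ * dispersion ω₂ (k₁ + k₂ - k₃) +
              2 * (ω₂ + 2)) * Real.cos ((k₁ + k₂) / 2) -
          4 * Real.cos ((k₃ - k₁) / 2) * Real.cos ((k₂ - k₃) / 2)) = 0 →
      Real.sin ((k₃ - k₁) / 2) * Real.sin ((k₂ - k₃) / 2) ≠ 0 →
      c ≤ |((dispersion ω₂ k₁ * groupVelocity ω₂ k₂ + dispersion ω₂ k₃ * groupVelocity ω₂ (k₁ + k₂ - k₃)) *
              Real.cos ((k₁ + k₂) / 2) -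
            1 / 2 * (dispersion ω₂ k₁ * dispersion ω₂ k₂ + dispersion ω₂ k₃ * dispersion ω₂ (k₁ + k₂ - k₃) +
              2 * (ω₂ + 2)) * Real.sin ((k₁ + k₂) / 2) +
          2 * Real.cos ((k₃ - k₁) / 2) * Real.sin ((k₂ - k₃) / 2))|) →
    (∀ ω₂ : ℝ, 0 < ω₂ → ∀ k₁ k₂ k₃ : ℝ,
      ((dispersion ω₂ k₁ * dispersion ω₂ k₂ + dispersion ω₂ k₃ * dispersion ω₂ (k₁ + k₂ - k₃) +
              2 * (ω₂ + 2)) * Real.cos ((k₁ + k₂) / 2) -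
          4 * Real.cos ((k₃ - k₁) / 2) * Real.cos ((k₂ - k₃) / 2)) = 0 →
      Real.sin ((k₃ - k₁) / 2) * Real.sin ((k₂ - k₃) / 2) = 0 →
      ((dispersion ω₂ k₁ * groupVelocity ω₂ k₂ + dispersion ω₂ k₃ * groupVelocity ω₂ (k₁ + k₂ - k₃)) *
              Real.cos ((k₁ + k₂) / 2) -
            1 / 2 * (dispersion ω₂ k₁ * dispersion ω₂ k₂ + dispersion ω₂ k₃ * dispersion ω₂ (k₁ + k₂ - k₃) +
              2 * (ω₂ + 2)) * Real.sin ((k₁ + k₂) / 2) +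
          2 * Real.cos ((k₃ - k₁) / 2) * Real.sin ((k₂ - k₃) / 2)) ≠ 0) →
    ∀ ω₂ : ℝ, 0 < ω₂ → ∃ m : ℝ, 0 < m ∧ ∀ k₁ k₃ : ℝ, Real.sin ((k₃ - k₁) / 2) ≠ 0 →
      groupVelocity ω₂ k₃ ≠ groupVelocity ω₂ k₁ → ∃ kt : ℝ, ∀ k₂ : ℝ,
        m * |Real.sin ((k₃ - k₁) / 2) * Real.sin ((k₂ - k₃) / 2) * Real.sin ((k₂ - kt) / 2)| ≤
          |resonanceFn ω₂ k₁ k₂ k₃| := by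
  intro hTA hTB ω₂ hω
  obtain ⟨η, hη, hfloor⟩ := fibreTwoZeroFloor_floor ω₂ hω (hTA ω₂ hω) (hTB ω₂ hω)
  have hMpos : 0 < (ω₂ + 4) * Real.sqrt (ω₂ + 4) := by
    have : 0 < Real.sqrt (ω₂ + 4) := Real.sqrt_pos.2 (by linarith)
    positivity
  refine ⟨η / ((ω₂ + 4) * Real.sqrt (ω₂ + 4)), div_pos hη hMpos, fun k₁ k₃ hsp hv => ?_⟩
  -- reduce `k₁`, `k₃` to the box
  obtain ⟨n₁, hn₁⟩ := bracketModulus_exists_reduce k₁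
  obtain ⟨n₃, hn₃⟩ := bracketModulus_exists_reduce k₃
  set k₁' := k₁ - n₁ * (2 * π) with hk₁'
  set k₃' := k₃ - n₃ * (2 * π) with hk₃'
  have hk₁'mem : k₁' ∈ Icc (-π) π := abs_le.1 hn₁
  have hk₃'mem : k₃' ∈ Icc (-π) π := abs_le.1 hn₃
  have hk₁eq : k₁ = k₁' + n₁ * (2 * π) := by rw [hk₁']; ring
  have hk₃eq : k₃ = k₃' + n₃ * (2 * π) := by rw [hk₃']; ring
  have hsp_eq : |Real.sin ((k₃ - k₁) / 2)| = |Real.sin ((k₃' - k₁') / 2)| := by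
    rw [show k₃ - k₁ = (k₃' - k₁') + (n₃ - n₁ : ℤ) * (2 * π) by rw [hk₁eq, hk₃eq]; push_cast; ring,
      fibreTwoZeroFloor_abs_sin_half_add_int]
  have hsp' : Real.sin ((k₃' - k₁') / 2) ≠ 0 := by
    intro h0; apply hsp; rw [← abs_eq_zero, hsp_eq, h0, abs_zero]
  have hv' : groupVelocity ω₂ k₃' ≠ groupVelocity ω₂ k₁' := by
    have e₁ : groupVelocity ω₂ k₁ = groupVelocity ω₂ k₁' := by
      have p := (fibreTwoZeroFloor_groupVelocity_periodic ω₂).int_mul n₁ k₁'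
      rw [hk₁eq, p]
    have e₃ : groupVelocity ω₂ k₃ = groupVelocity ω₂ k₃' := by
      have p := (fibreTwoZeroFloor_groupVelocity_periodic ω₂).int_mul n₃ k₃'
      rw [hk₃eq, p]
    rw [← e₁, ← e₃]; exact hv
  obtain ⟨kt, hkt⟩ := fibreTwoZeroFloor_core hω hη hfloor hk₁'mem hk₃'mem hsp' hv'
  refine ⟨kt, fun k₂ => ?_⟩
  have hΩ : resonanceFn ω₂ k₁ k₂ k₃ = resonanceFn ω₂ k₁' k₂ k₃' := by
    have p₁ := (fibreTwoZeroFloor_resonanceFn_periodic₁ ω₂ k₂ (k₃' + n₃ * (2 * π))).int_mul n₁ k₁'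
    have p₃ := (fibreTwoZeroFloor_resonanceFn_periodic₃ ω₂ k₁' k₂).int_mul n₃ k₃'
    rw [hk₁eq, hk₃eq, p₁, p₃]
  have hs₂ : |Real.sin ((k₂ - k₃) / 2)| = |Real.sin ((k₂ - k₃') / 2)| := by
    rw [show k₂ - k₃ = (k₂ - k₃') + (-n₃ : ℤ) * (2 * π) by rw [hk₃eq]; push_cast; ring,
      fibreTwoZeroFloor_abs_sin_half_add_int]
  have h := hkt k₂
  rw [abs_mul, abs_mul] at h ⊢
  rw [hΩ, hsp_eq, hs₂]
  exact h

end Summit.AtomisticToContinuum.FouriersLaw.Theorems.MourreDissolution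

end
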